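import Mathlib
import HarnessLib
import Literature.NumberTheory.LFunctions.SuzukiSingleOperatorKernelProofs
import Summits.RiemannHypothesis.RiemannHypothesis.Theses.DeBrangesSuzukiDoor

/-!
# RiemannHypothesis / DeBrangesSuzukiDoor — crux `KernelLaplaceIdentity` (K4, stmt-RiemannHypothesis-19726) PROVED

The route crux K4: for every `θ > 10` and every `z` with `Im z > 1`, `x ↦ K_θ(x) e^{izx}` is integrable on `(0,∞)`
and `∫₀^∞ K_θ(x) e^{izx} dx = Θ_θ(z)`. Immediate from the Literature theorem
`Literature.NumberTheory.LFunctions.Suzuki2020_thm12_laplace` ([Su20] = Suzuki, ASPM 84 (2020), arXiv:1907.07302,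
Thm 1.2 (K-ii), PROVED in the tree for every `θ > 1` and `Im z > 1/2` by rh-columns-lit g2, p408554: Mathlib Fourier
inversion `Continuous.fourierInv_fourier_eq` rescaled, growth `|K_θ(x)| ≤ D e^{bx}`). The route decl's `let Θ` /
`let K` are `limTheta θ` / `limKernel θ` by `rfl`. RH-FREE theorem; nothing here bears on the truth of RH.
-/

noncomputable section

-- D-0017: `Summit.<S>.<S>.…` is the designed namespace of a single-problem summit.
set_option linter.dupNamespace false

namespace Summit.RiemannHypothesis.RiemannHypothesis.Theorems

/-- **Route `DeBrangesSuzukiDoor`, crux `KernelLaplaceIdentity` (K4, stmt-RiemannHypothesis-19726) — PROVED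
(RH-FREE).** For `θ > 10`, `Im z > 1`: `∫₀^∞ K_θ(x) e^{izx} dx = Θ_θ(z)` absolutely ([Su20] Thm 1.2 (K-ii), tree
theorem for all `θ > 1`, `Im z > 1/2`). -/
theorem kernelLaplaceIdentity_proof : Theses.DeBrangesSuzukiDoor.KernelLaplaceIdentity := by
  intro θ hθ Θ K z hz
  exact Literature.NumberTheory.LFunctions.Suzuki2020_thm12_laplace (θ := θ) (by linarith) (by linarith)

end Summit.RiemannHypothesis.RiemannHypothesis.Theorems

end
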